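import Summits.Parity.BatemanHorn.Theorems.AlmostPrimeZerosLinearCappedRepulsionRankinMajorant
import Summits.Parity.BatemanHorn.Theorems.AlmostPrimeZerosLinearCappedRepulsionShortIntervalCapped
import Summits.Parity.BatemanHorn.Theorems.AlmostPrimeZerosLinearCappedRepulsionCappedEulerData
import Summits.Parity.BatemanHorn.Theorems.AlmostPrimeZerosLinearCappedRepulsionRieszDiffEngine

/-!
# Crux `LinearCappedRepulsion` (stmt-Parity-11327), line `jensen-stieltjes-majorant`: the tilted majorant

Everything here is PROVED.  The one-sided majorant with the HARMONIC exponent,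
`‖Σ_{0≤n≤x} z^{s(n)}‖ ≤ (x + 1)·exp(log log x·(Re z − 1) + A(1 + ‖z − 1‖)^{3/2})` on
`‖z − 1‖ ≤ (log log x)/C`, `x ≥ x₀` (`tiltedMajorant`), assembled (`tiltedMajorant_of_parts`) from the
landed stubs `stub_cappedEulerData` (Euler-product data of the capped statistic with explicit
`B(R) = exp(b(1+R)^{3/2})`), `stub_rieszDiffEngine` (one-sided Selberg–Delange bound for the
difference of Riesz means `A₁(x+h) − A₁(x)`, `h = x e^{−(log log x)³}`), `stub_shortIntervalCapped`
(the de-smoothing error `Σ_{x<n≤x+h} R^{s(n)} ≤ x (log x)^{−R−1}`) and `stub_rankinMajorant`: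
`A(x)·h = (A₁(x+h) − A₁(x)) − Σ_{x<n≤x+h} z^{s(n)}(x + h − n)`, `R := 1 + ‖z − 1‖`.
-/

namespace Summit.Parity.BatemanHorn.Cruxes.LinearCappedRepulsion.JensenStieltjesMajorant

open scoped BigOperators
open Literature.NumberTheory.LFunctions

/-- **Composition of the analytic stub (kernel-checked, no `sorry`): Stubs 1a, 1b, 1c and 2 imply the
one-sided tilted majorant** `‖P_x(z)‖ ≤ (x + 1)·exp(log log x·(Re z − 1) + A(1 + ‖z − 1‖)^{3/2})` on
`‖z − 1‖ ≤ (log log x)/C`, `x ≥ x₀`.  Bookkeeping: `C := 2·max C₁ 1` (`C₁` from Stub 1c), so that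
`R := 1 + ‖z − 1‖` satisfies `1 ≤ R ≤ log log x` and `R ≤ log log x / C₁` as soon as `log log x ≥ C`;
`h := x·e^{−(log log x)³}`; `A(x)·h = (A₁(x+h) − A₁(x)) − Σ_{x<n≤x+h} z^{s(n)}(x + h − n)` with
`|x + h − n| ≤ h`, `‖z‖^{s(n)} ≤ R^{s(n)}`; `P_x(z) = 1 + A(x)`; `(log x)^{−R−1} ≤ (log x)^{Re z−1} =
exp(log log x·(Re z−1))`; `A := 3(b + c) + 1` absorbs `(1+R)^{3/2} ≤ 3(1+‖z−1‖)^{3/2}` and the `+1`'s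
(`x·(log x)^{Re z−1} ≥ exp(e^L − L²/2) ≥ e`). -/
theorem tiltedMajorant_of_parts
    (hEuler : ∃ b : ℝ, 0 ≤ b ∧ ∀ R : ℝ, 0 ≤ R → ∀ z : ℂ, ‖z‖ ≤ R → ∃ G : ℂ → ℂ,
      SelbergDelange.RieszData R (4 / 5) (Real.exp (b * (1 + R) ^ (3 / 2 : ℝ))) z
        (fun n : ℕ => z ^ (n.factorization.sum fun _ v => min v 2)) G)
    (hEngine : ∃ X₀ : ℝ, ∃ c : ℝ, 0 ≤ c ∧ ∀ (R B : ℝ) (z : ℂ) (a : ℕ → ℂ) (G : ℂ → ℂ), 1 ≤ R →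
      SelbergDelange.RieszData R (4 / 5) B z a G →
      ∀ x h : ℝ, X₀ ≤ x → R ≤ Real.log (Real.log x) →
        x * Real.exp (-(Real.log (Real.log x) ^ 3)) ≤ h → h ≤ x →
        ‖(∑ n ∈ Finset.Ioc 0 ⌊x + h⌋₊, a n * (((x + h : ℝ) : ℂ) - n)) -
            ∑ n ∈ Finset.Ioc 0 ⌊x⌋₊, a n * ((x : ℂ) - n)‖ ≤
          h * x * Real.log x ^ (z.re - 1) * B * Real.exp (c * (1 + R) ^ (3 / 2 : ℝ)))
    (hShort : ∀ B : ℝ, 0 ≤ B →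
      (∀ x : ℕ, 3 ≤ x → ∀ y : ℝ, 1 ≤ y →
        ∑ n ∈ Finset.range (x + 1), y ^ (n.factorization.sum fun _ v => min v 2) ≤
          ((x : ℝ) + 1) * Real.exp (B * y * Real.log (Real.log x) + B * y ^ (3 / 2 : ℝ))) →
      ∃ C : ℝ, 0 < C ∧ ∃ x₁ : ℕ, ∀ x : ℕ, x₁ ≤ x → ∀ R : ℝ, 1 ≤ R →
        R ≤ Real.log (Real.log x) / C →
        ∑ n ∈ Finset.Ioc x ⌊(x : ℝ) + x * Real.exp (-(Real.log (Real.log x) ^ 3))⌋₊,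
            R ^ (n.factorization.sum fun _ v => min v 2) ≤
          (x : ℝ) * Real.log x ^ (-R - 1))
    (hRankin : ∃ B : ℝ, 0 ≤ B ∧ ∀ x : ℕ, 3 ≤ x → ∀ y : ℝ, 1 ≤ y →
      ∑ n ∈ Finset.range (x + 1), y ^ (n.factorization.sum fun _ v => min v 2) ≤
        ((x : ℝ) + 1) * Real.exp (B * y * Real.log (Real.log x) + B * y ^ (3 / 2 : ℝ))) :
    ∃ A : ℝ, 0 ≤ A ∧ ∃ C : ℝ, 0 < C ∧ ∃ x₀ : ℕ, ∀ x : ℕ, x₀ ≤ x → ∀ z : ℂ,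
      ‖z - 1‖ ≤ Real.log (Real.log x) / C →
      ‖∑ n ∈ Finset.range (x + 1), z ^ (n.factorization.sum fun _ v => min v 2)‖ ≤
        ((x : ℝ) + 1) * Real.exp (Real.log (Real.log x) * (z.re - 1) + A * (1 + ‖z - 1‖) ^ (3 / 2 : ℝ)) := by
  obtain ⟨b, hb0, hEul⟩ := hEuler
  obtain ⟨X₀, c, hc0, hEng⟩ := hEngine
  obtain ⟨Br, hBr0, hrank⟩ := hRankin
  obtain ⟨C₁, hC₁, x₁, hshort⟩ := hShort Br hBr0 hrank
  -- constants
  set C : ℝ := 2 * max C₁ 1 with hCdef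
  have hC2 : (2 : ℝ) ≤ C := by have := le_max_right C₁ 1; rw [hCdef]; linarith
  have hCC₁ : 2 * C₁ ≤ C := by have := le_max_left C₁ 1; rw [hCdef]; linarith
  have hC : 0 < C := by linarith
  set A : ℝ := 3 * (b + c) + 1 with hAdef
  have hA0 : 0 ≤ A := by rw [hAdef]; positivity
  set x₀ : ℕ := max (max x₁ ⌈X₀⌉₊) ⌈Real.exp (Real.exp C)⌉₊ with hx₀def
  refine ⟨A, hA0, C, hC, x₀, fun x hx z hz => ?_⟩
  -- unpacking the threshold
  have hx₁ : x₁ ≤ x := le_trans ((le_max_left _ _).trans (le_max_left _ _)) hx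
  have hX₀ : X₀ ≤ (x : ℝ) :=
    (Nat.le_ceil X₀).trans (by exact_mod_cast ((le_max_right _ _).trans (le_max_left _ _)).trans hx)
  have hxexp : Real.exp (Real.exp C) ≤ (x : ℝ) :=
    (Nat.le_ceil _).trans (by exact_mod_cast (le_max_right _ _).trans hx)
  have hxpos : (0 : ℝ) < x := (Real.exp_pos _).trans_le hxexp
  have hlogx : Real.exp C ≤ Real.log x := (Real.le_log_iff_exp_le hxpos).2 hxexp
  set 𝓛 : ℝ := Real.log x with h𝓛def
  have h𝓛pos : 0 < 𝓛 := (Real.exp_pos _).trans_le hlogx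
  set L : ℝ := Real.log 𝓛 with hLdef
  have hCL : C ≤ L := (Real.le_log_iff_exp_le h𝓛pos).2 hlogx
  have hL2 : 2 ≤ L := hC2.trans hCL
  have hL0 : 0 < L := by linarith
  have h𝓛1 : 1 ≤ 𝓛 := by
    have : Real.exp C ≥ 1 := Real.one_le_exp hC.le
    linarith
  -- the radius
  set r : ℝ := ‖z - 1‖ with hrdef
  have hr0 : 0 ≤ r := norm_nonneg _
  set R : ℝ := 1 + r with hRdef
  have hR1 : 1 ≤ R := by rw [hRdef]; linarith
  have hR0 : 0 ≤ R := by linarith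
  have hzR : ‖z‖ ≤ R := by
    have h := norm_add_le (z - 1) 1
    simp only [sub_add_cancel, norm_one] at h
    rw [hRdef, hrdef]; linarith
  have hrLC : r ≤ L / C := hz
  have hrL2 : r ≤ L / 2 := hrLC.trans (div_le_div_of_nonneg_left hL0.le (by norm_num) hC2)
  have hRL : R ≤ L := by rw [hRdef]; linarith
  have hRC₁ : R ≤ L / C₁ := by
    -- `1 + r ≤ 1 + L/C ≤ L/(2C₁) + L/(2C₁) = L/C₁` using `L ≥ C ≥ 2C₁`
    have h1 : L / C ≤ L / (2 * C₁) := div_le_div_of_nonneg_left hL0.le (by positivity) hCC₁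
    have h2 : 1 ≤ L / (2 * C₁) := by
      rw [le_div_iff₀ (by positivity)]; linarith
    have h3 : L / (2 * C₁) + L / (2 * C₁) = L / C₁ := by field_simp; ring
    rw [hRdef]; linarith
  have hrez' : -r ≤ z.re - 1 := by
    have h1 : |(z - 1).re| ≤ ‖z - 1‖ := Complex.abs_re_le_norm _
    have h2 : (z - 1).re = z.re - 1 := by simp
    rw [h2] at h1
    rw [hrdef]
    linarith [neg_abs_le (z.re - 1)]
  have hrez : -R ≤ z.re - 1 := by rw [hRdef]; linarith
  -- the data and the engine
  obtain ⟨G, hData⟩ := hEul R hR0 z hzR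
  set h : ℝ := (x : ℝ) * Real.exp (-(Real.log (Real.log x) ^ 3)) with hhdef
  have hhpos : 0 < h := mul_pos hxpos (Real.exp_pos _)
  have hhx : h ≤ x := by
    have : Real.exp (-(Real.log (Real.log x) ^ 3)) ≤ 1 := by
      rw [Real.exp_le_one_iff, neg_nonpos]; positivity
    calc h = (x : ℝ) * Real.exp (-(Real.log (Real.log x) ^ 3)) := rfl
      _ ≤ (x : ℝ) * 1 := by gcongr
      _ = x := mul_one _
  have hEngx := hEng R _ z _ G hR1 hData x h hX₀ hRL le_rfl hhx
  -- the short sum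
  have hShortx := hshort x hx₁ R hR1 hRC₁
  -- notation for the sums
  set sfun : ℕ → ℕ := fun n => n.factorization.sum fun _ v => min v 2 with hsfun
  set a : ℕ → ℂ := fun n => z ^ sfun n with hadef
  set m : ℕ := ⌊(x : ℝ) + h⌋₊ with hmdef
  have hxm : x ≤ m := by
    rw [hmdef]; exact Nat.le_floor (by linarith)
  have hmxh : (m : ℝ) ≤ x + h := Nat.floor_le (by positivity)
  have hfloorx : ⌊(x : ℝ)⌋₊ = x := Nat.floor_natCast x
  -- A(x) and the decomposition A₁(x+h) − A₁(x) = h·A(x) + E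
  set Ax : ℂ := ∑ n ∈ Finset.Ioc 0 x, a n with hAxdef
  set E : ℂ := ∑ n ∈ Finset.Ioc x m, a n * (((x + h : ℝ) : ℂ) - n) with hEdef
  have hdecomp : (∑ n ∈ Finset.Ioc 0 m, a n * (((x + h : ℝ) : ℂ) - n)) -
      ∑ n ∈ Finset.Ioc 0 ⌊(x : ℝ)⌋₊, a n * (((x : ℝ) : ℂ) - n) = (h : ℂ) * Ax + E := by
    rw [hfloorx, ← Finset.sum_Ioc_consecutive _ (Nat.zero_le x) hxm, hAxdef, hEdef, Finset.mul_sum,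
      add_sub_right_comm, ← Finset.sum_sub_distrib]
    congr 1
    refine Finset.sum_congr rfl fun n _ => ?_
    push_cast
    ring
  -- ‖E‖ ≤ h · Σ_{x<n≤m} R^{s(n)} ≤ h · x · 𝓛^{−R−1}
  have hE : ‖E‖ ≤ h * ((x : ℝ) * 𝓛 ^ (-R - 1)) := by
    have hterm : ∀ n ∈ Finset.Ioc x m, ‖a n * (((x + h : ℝ) : ℂ) - n)‖ ≤ R ^ sfun n * h := by
      intro n hn
      rw [Finset.mem_Ioc] at hn
      rw [norm_mul, hadef]
      refine mul_le_mul ?_ ?_ (norm_nonneg _) (by positivity)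
      · simp only [norm_pow]
        exact pow_le_pow_left₀ (norm_nonneg _) hzR _
      · have hn1 : (x : ℝ) < n := by exact_mod_cast hn.1
        have hn2 : (n : ℝ) ≤ m := by exact_mod_cast hn.2
        have : (((x + h : ℝ) : ℂ) - n) = (((x + h - n : ℝ)) : ℂ) := by push_cast; ring
        rw [this, Complex.norm_real, Real.norm_eq_abs, abs_le]
        constructor <;> linarith
    calc ‖E‖ ≤ ∑ n ∈ Finset.Ioc x m, ‖a n * (((x + h : ℝ) : ℂ) - n)‖ := norm_sum_le _ _
      _ ≤ ∑ n ∈ Finset.Ioc x m, R ^ sfun n * h := Finset.sum_le_sum hterm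
      _ = h * ∑ n ∈ Finset.Ioc x m, R ^ sfun n := by rw [Finset.mul_sum]; simp [mul_comm]
      _ ≤ h * ((x : ℝ) * 𝓛 ^ (-R - 1)) := by
          refine mul_le_mul_of_nonneg_left ?_ hhpos.le
          simpa [hmdef, hhdef, hsfun] using hShortx
  -- the engine bound
  set B : ℝ := Real.exp (b * (1 + R) ^ (3 / 2 : ℝ)) with hBdef
  have hD : ‖(h : ℂ) * Ax + E‖ ≤ h * x * 𝓛 ^ (z.re - 1) * B * Real.exp (c * (1 + R) ^ (3 / 2 : ℝ)) := by
    rw [← hdecomp]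
    simpa [hmdef, hadef, hsfun] using hEngx
  -- hence the bound for A(x)
  have h𝓛mono : 𝓛 ^ (-R - 1) ≤ 𝓛 ^ (z.re - 1) :=
    Real.rpow_le_rpow_of_exponent_le h𝓛1 (by linarith)
  set E₁ : ℝ := B * Real.exp (c * (1 + R) ^ (3 / 2 : ℝ)) with hE₁def
  have hE₁ : E₁ = Real.exp ((b + c) * (1 + R) ^ (3 / 2 : ℝ)) := by
    rw [hE₁def, hBdef, ← Real.exp_add]; ring_nf
  have hE₁1 : 1 ≤ E₁ := by rw [hE₁]; exact Real.one_le_exp (by positivity)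
  have hAx : ‖Ax‖ ≤ (x : ℝ) * 𝓛 ^ (z.re - 1) * (E₁ + 1) := by
    have h1 : ‖(h : ℂ) * Ax‖ = h * ‖Ax‖ := by
      rw [norm_mul, Complex.norm_real, Real.norm_of_nonneg hhpos.le]
    have h2 : ‖(h : ℂ) * Ax‖ ≤ ‖(h : ℂ) * Ax + E‖ + ‖E‖ := by
      have := norm_sub_le ((h : ℂ) * Ax + E) E
      simpa using this
    have h3 : h * ‖Ax‖ ≤ h * ((x : ℝ) * 𝓛 ^ (z.re - 1) * (E₁ + 1)) := by
      rw [← h1]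
      calc ‖(h : ℂ) * Ax‖ ≤ ‖(h : ℂ) * Ax + E‖ + ‖E‖ := h2
        _ ≤ h * x * 𝓛 ^ (z.re - 1) * B * Real.exp (c * (1 + R) ^ (3 / 2 : ℝ)) +
              h * ((x : ℝ) * 𝓛 ^ (-R - 1)) := add_le_add hD hE
        _ ≤ h * x * 𝓛 ^ (z.re - 1) * B * Real.exp (c * (1 + R) ^ (3 / 2 : ℝ)) +
              h * ((x : ℝ) * 𝓛 ^ (z.re - 1)) := by gcongr
        _ = h * ((x : ℝ) * 𝓛 ^ (z.re - 1) * (E₁ + 1)) := by rw [hE₁def]; ring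
    exact le_of_mul_le_mul_left h3 hhpos
  -- P_x(z) = 1 + A(x)
  have hrange : Finset.range (x + 1) = insert 0 (Finset.Ioc 0 x) := by
    ext n; simp only [Finset.mem_range, Finset.mem_insert, Finset.mem_Ioc]; omega
  have hP : ∑ n ∈ Finset.range (x + 1), z ^ sfun n = 1 + Ax := by
    rw [hrange, Finset.sum_insert (by simp), hAxdef, hadef]
    simp [hsfun]
  -- sizes: x·𝓛^{Re z − 1} ≥ e ≥ 2 and the exponent bookkeeping
  have h𝓛eq : 𝓛 = Real.exp L := by rw [hLdef, Real.exp_log h𝓛pos]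
  have hxeq : (x : ℝ) = Real.exp 𝓛 := by rw [h𝓛def, Real.exp_log hxpos]
  have hpow : 𝓛 ^ (z.re - 1) = Real.exp (L * (z.re - 1)) := by
    rw [Real.rpow_def_of_pos h𝓛pos, hLdef]
  have hbig : 2 ≤ (x : ℝ) * 𝓛 ^ (z.re - 1) := by
    -- `x 𝓛^{Re z−1} = exp(e^L + L(Re z − 1)) ≥ exp(e^L − L·r) ≥ exp(e^L − L²/2) ≥ exp 1 ≥ 2`
    rw [hxeq, hpow, ← Real.exp_add, h𝓛eq]
    have h1 : L * (z.re - 1) ≥ -(L * r) := by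
      have := mul_le_mul_of_nonneg_left hrez' hL0.le
      linarith
    have h2 : L * r ≤ L ^ 2 / 2 := by
      have := mul_le_mul_of_nonneg_left hrL2 hL0.le
      have e : L * (L / 2) = L ^ 2 / 2 := by ring
      linarith
    have h3 : 1 + L ^ 2 / 2 ≤ Real.exp L := by
      have := Real.quadratic_le_exp_of_nonneg hL0.le
      linarith
    have h4 : (1 : ℝ) ≤ Real.exp L + L * (z.re - 1) := by linarith
    calc (2 : ℝ) ≤ Real.exp 1 := by have := Real.add_one_le_exp (1 : ℝ); linarith
      _ ≤ Real.exp (Real.exp L + L * (z.re - 1)) := Real.exp_le_exp.2 h4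
  have hexpA : Real.exp 1 * E₁ ≤ Real.exp (A * (1 + r) ^ (3 / 2 : ℝ)) := by
    rw [hE₁, ← Real.exp_add, Real.exp_le_exp, hAdef, hRdef]
    -- `(b+c)(2+r)^{3/2} + 1 ≤ (3(b+c)+1)(1+r)^{3/2}` from `(2+r)^{3/2} ≤ 3(1+r)^{3/2}`, `(1+r)^{3/2} ≥ 1`
    have h1 : (1 : ℝ) ≤ (1 + r) ^ (3 / 2 : ℝ) := Real.one_le_rpow (by linarith) (by norm_num)
    have h2 : (1 + (1 + r)) ^ (3 / 2 : ℝ) ≤ 3 * (1 + r) ^ (3 / 2 : ℝ) := by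
      have h21 : (1 + (1 + r)) ≤ 2 * (1 + r) := by linarith
      have h22 : (1 + (1 + r)) ^ (3 / 2 : ℝ) ≤ (2 * (1 + r)) ^ (3 / 2 : ℝ) :=
        Real.rpow_le_rpow (by linarith) h21 (by norm_num)
      have h23 : (2 * (1 + r)) ^ (3 / 2 : ℝ) = 2 ^ (3 / 2 : ℝ) * (1 + r) ^ (3 / 2 : ℝ) :=
        Real.mul_rpow (by norm_num) (by linarith)
      have h24 : (2 : ℝ) ^ (3 / 2 : ℝ) ≤ 3 := by
        have hsq : ((2 : ℝ) ^ (3 / 2 : ℝ)) ^ (2 : ℕ) = 8 := by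
          rw [← Real.rpow_natCast, ← Real.rpow_mul (by norm_num)]; norm_num
        have h9 : ((2 : ℝ) ^ (3 / 2 : ℝ)) ^ (2 : ℕ) ≤ 3 ^ (2 : ℕ) := by rw [hsq]; norm_num
        exact (pow_le_pow_iff_left₀ (by positivity) (by norm_num) (by norm_num)).1 h9
      calc (1 + (1 + r)) ^ (3 / 2 : ℝ) ≤ 2 ^ (3 / 2 : ℝ) * (1 + r) ^ (3 / 2 : ℝ) := h22.trans h23.le
        _ ≤ 3 * (1 + r) ^ (3 / 2 : ℝ) := by gcongr
    have hbc : 0 ≤ b + c := by positivity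
    linarith only [mul_le_mul_of_nonneg_left h2 hbc, h1]
  -- conclusion
  rw [hP]
  have hfinal : 1 + (x : ℝ) * 𝓛 ^ (z.re - 1) * (E₁ + 1) ≤
      ((x : ℝ) + 1) * Real.exp (Real.log (Real.log x) * (z.re - 1) + A * (1 + r) ^ (3 / 2 : ℝ)) := by
    rw [Real.exp_add, ← hpow]
    have h𝓛p : 0 ≤ 𝓛 ^ (z.re - 1) := by positivity
    obtain ⟨Q, hQ⟩ : ∃ Q : ℝ, Q = (x : ℝ) * 𝓛 ^ (z.re - 1) := ⟨_, rfl⟩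
    rw [← hQ] at hbig ⊢
    have hQ0 : 0 ≤ Q := by rw [hQ]; positivity
    have hE₁0 : 0 ≤ E₁ := by linarith
    have he : Real.exp 1 * E₁ ≤ Real.exp (A * (1 + r) ^ (3 / 2 : ℝ)) := hexpA
    have he1 : (2.5 : ℝ) ≤ Real.exp 1 := by
      have := Real.exp_one_gt_d9; linarith
    -- (x+1)·𝓛^{Re z−1}·e^{A…} ≥ Q·e·E₁ ≥ Q(E₁+1) + Q·(e−2)E₁ ≥ Q(E₁+1) + 1
    have k1 : Q * ((2.5 : ℝ) * E₁) ≤ Q * (Real.exp 1 * E₁) :=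
      mul_le_mul_of_nonneg_left (mul_le_mul_of_nonneg_right he1 hE₁0) hQ0
    have k3 : (2 : ℝ) * (1 / 2) ≤ Q * ((1.5 : ℝ) * E₁ - 1) :=
      mul_le_mul hbig (by linarith) (by norm_num) hQ0
    calc 1 + Q * (E₁ + 1) ≤ Q * (Real.exp 1 * E₁) := by linarith only [k1, k3]
      _ ≤ Q * Real.exp (A * (1 + r) ^ (3 / 2 : ℝ)) := mul_le_mul_of_nonneg_left he hQ0
      _ ≤ ((x : ℝ) + 1) * 𝓛 ^ (z.re - 1) * Real.exp (A * (1 + r) ^ (3 / 2 : ℝ)) := by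
          rw [hQ]
          exact mul_le_mul_of_nonneg_right (mul_le_mul_of_nonneg_right (by linarith) h𝓛p)
            (Real.exp_pos _).le
      _ = ((x : ℝ) + 1) * (𝓛 ^ (z.re - 1) * Real.exp (A * (1 + r) ^ (3 / 2 : ℝ))) := by ring
  calc ‖1 + Ax‖ ≤ ‖(1 : ℂ)‖ + ‖Ax‖ := norm_add_le _ _
    _ ≤ 1 + (x : ℝ) * 𝓛 ^ (z.re - 1) * (E₁ + 1) := by rw [norm_one]; gcongr
    _ ≤ _ := hfinal

/-- **The one-sided tilted majorant with the harmonic exponent** (formerly `stub_tiltedMajorant`; now a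
theorem modulo Stubs 1a–1c and 2): there are `A ≥ 0`, `C > 0`, `x₀` such that for all `x ≥ x₀` and all
`‖z − 1‖ ≤ (log log x)/C`: `‖Σ_{0≤n≤x} z^{s(n)}‖ ≤ (x + 1)·exp(log log x·(Re z − 1) + A(1 + ‖z − 1‖)^{3/2})`. -/
theorem tiltedMajorant :
    ∃ A : ℝ, 0 ≤ A ∧ ∃ C : ℝ, 0 < C ∧ ∃ x₀ : ℕ, ∀ x : ℕ, x₀ ≤ x → ∀ z : ℂ,
      ‖z - 1‖ ≤ Real.log (Real.log x) / C →
      ‖∑ n ∈ Finset.range (x + 1), z ^ (n.factorization.sum fun _ v => min v 2)‖ ≤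
        ((x : ℝ) + 1) * Real.exp (Real.log (Real.log x) * (z.re - 1) + A * (1 + ‖z - 1‖) ^ (3 / 2 : ℝ)) :=
  tiltedMajorant_of_parts stub_cappedEulerData stub_rieszDiffEngine stub_shortIntervalCapped
    stub_rankinMajorant


end Summit.Parity.BatemanHorn.Cruxes.LinearCappedRepulsion.JensenStieltjesMajorant
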